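import Summits.BirchSwinnertonDyer.BirchSwinnertonDyer.Theorems.SchneiderFreeAdditiveX3SemistableTwistLocalAnyLine
import Literature.NumberTheory.EllipticCurves.GeomReductionFrobeniusProofs
import Literature.NumberTheory.EllipticCurves.SerreOpenImageOrdinaryReductionProofs
import Literature.NumberTheory.EllipticCurves.SerreOpenImageDeterminantProofs
import Literature.NumberTheory.GaloisRepresentations.SerreProp18GL2Fp
import Literature.NumberTheory.GaloisRepresentations.SerreSubgroupsGL2Fp
import Mathlib.NumberTheory.GaussSum
import HarnessLib

/-!
# Route `SchneiderFreeAdditiveX3` (K1 door), local tools at the additive prime: the DETERMINANT STEP `det ρ̄ = χ̄_p`,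
# `√p* ∈ ℚ(ζ_p)`, and the KERNEL-OF-REDUCTION LINE of a good ordinary curve with an inertia-corrected Frobenius

Cell `bsd-schneider-ideate`, seat `bsd-schneider-door-c5` (prover, generation 25; assembly layer; `--supports` 19177).
PARTITION: board row B6 ∩ X3 ∩ sst-twist, `r = 1` (7 101 pairs; (G-ord, `e = 2`) half 2 560, of which 2 411 at `p = 3`) of
`Rank1Residual.partition`; types-the-object-of nothing new; the three group-theoretic tools of the companion file
`…SemistableTwistLocalThree` (the non-anomalous clause `hna` at `p = 3` from the Frobenius of the twist); closes none of B6's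
cells (BSD NOT advanced). bears_on: K1-door (items 18971/18972 → 19177 r3) + K1-wing (20365).

* §0 `det_eq_of_mulVec_eq_self_of_forall_sub_smul` (a `2 × 2` matrix fixing `v ≠ 0` and acting on `F²/Fv` by `c` has
  determinant `c`), `intCast_eq_of_smul_eq_self_of_forall_sub_zsmul_mem` (for `φ ∈ Γ_ℚ` fixing `T₀ ∈ W[p] ∖ 0` and acting on
  `W[p]/ℤT₀` by an integer `a`: `χ̄_p(φ) = a (mod p)` — `det ρ̄_{W,p} = χ̄_p` by the Weil pairing, tree
  `exists_frame_galoisRepTorsion_rat`).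
* §1 `smul_geomSqrt_pStar_eq_of_modPCyclotomicCharacterZMod_eq_one`: `χ̄_p(σ) = 1 ⇒ σ√p* = √p*` (`p` odd; the quadratic Gauss
  sum `g ∈ ℚ(ζ_p)` has `g² = p*`, Mathlib `gaussSum_sq`; the tree's `Kato2004.smul_geomSqrt_primeStar_eq` asks `σ` to fix ALL
  `p`-power roots of unity, only `ζ_p` is needed).
* §2 `exists_kernelLine_frobenius`: for `V/ℚ` globally minimal, good ORDINARY at the odd prime `p`, `v` the place at `p`: a prime
  `𝔓 ∣ v` of `\bar ℤ`, a line `K ≤ V[p]` (the kernel of the reduction `V[p] → Ṽ(𝔽̄_p)`; `#K = p`) with `τx − x ∈ K` for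
  `τ ∈ I_𝔓` (`geomReduction_smul_of_mem_inertia`), and `φ ∈ D_𝔓` with `χ̄_p(φ) = 1` and `φx − a_p(V)x ∈ K` on `V[p]`
  (`φ = σ·τ₀`: an arithmetic Frobenius, which acts on the reduction of `V[p]` by `a_p` — Serre 1972 §1.11 (1), tree
  `geomReduction_smul_eq_frobeniusTrace_smul` — times an inertia element with `χ̄_p(τ₀) = χ̄_p(σ)⁻¹`, `χ̄_p(I_𝔓) = 𝔽_pˣ`).
  `K ≠ ⊤` as the reduction is non-zero on `V[p]` (`p ∤ a_p`); `K ≠ ⊥` as an inertia element with `χ̄_p = −1 ≠ 1` (`p` odd)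
  cannot act trivially on `V[p]` (§0).

HONEST FRAMING: theorems only (finite group theory on the `𝔽_p`-plane over tree theorems); no definition, no named fact, no
`sorry`; nothing about BSD or a main conjecture is asserted; «closes rung: none».  References: Serre, Invent. Math. 15 (1972)
§1.11 (1), Prop. 11, §5.2 (iii) [Serre1972]; Mazur, Invent. Math. 18 (1972) §1 [Mazur1972]; Silverman *AEC* III.8 [SilvermanAEC2009];
Ireland–Rosen Prop. 6.3.2 [IrelandRosen1990].
-/

set_option autoImplicit false
set_option linter.dupNamespace false -- the summit namespace `…BirchSwinnertonDyer.BirchSwinnertonDyer.Theorems` (Sub = Summit, D-0017) trips it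

noncomputable section

open scoped Classical NumberField Pointwise Matrix

open WeierstrassCurve NumberField IsDedekindDomain Field Rat.HeightOneSpectrum
  Literature.NumberTheory.EllipticCurves Literature.NumberTheory.GaloisRepresentations
  Literature.NumberTheory.GaloisRepresentations.Serre1972
  Literature.NumberTheory.EllipticCurves.Rank1Residual
  Summit.BirchSwinnertonDyer.Rank1Residual Summit.BirchSwinnertonDyer.Rank1Residual.GaloisImage
  Summit.BirchSwinnertonDyer.Rank1Residual.Additive
  Summit.BirchSwinnertonDyer.BirchSwinnertonDyer.Theorems.SchneiderFreeAdditiveX3.SemistableTwistLocal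

namespace Summit.BirchSwinnertonDyer.BirchSwinnertonDyer.Theorems.SchneiderFreeAdditiveX3.SemistableTwistLocalThree

/-! ### §0 The determinant step: `det = χ̄_p` in a frame -/

section Det

/-- A `2 × 2` matrix fixing `v ≠ 0` and acting on `F²/F v` as the scalar `c` (`g w − c w ∈ F v` for all `w`) has determinant `c`
(in a basis `(v, w)` it is `(1 b; 0 c)`).  The transpose situation of the tree's `det_eq_of_sub_mem_line`. [folklore] -/
theorem det_eq_of_mulVec_eq_self_of_forall_sub_smul {F : Type*} [Field F]
    {g : Matrix (Fin 2) (Fin 2) F} {v : Fin 2 → F} (hv : v ≠ 0) {c : F}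
    (hgv : g *ᵥ v = v) (hquot : ∀ w : Fin 2 → F, ∃ b : F, g *ᵥ w - c • w = b • v) :
    g.det = c := by
  obtain ⟨w, hw⟩ := exists_det_cols_ne_zero hv
  obtain ⟨b, hb⟩ := hquot w
  have hgw : g *ᵥ w = c • w + b • v := by rw [← hb, add_sub_cancel]
  -- `g P = P M` with `P = (v | w)` and `M = (1 b; 0 c)`
  have hPdet : (!![v 0, w 0; v 1, w 1] : Matrix (Fin 2) (Fin 2) F).det ≠ 0 := by
    rw [Matrix.det_fin_two_of]
    exact hw
  have hgP : g * !![v 0, w 0; v 1, w 1] = !![v 0, w 0; v 1, w 1] * !![(1 : F), b; 0, c] := by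
    rw [mul_cols, hgw, hgv]
    ext i j
    fin_cases i <;> fin_cases j <;>
      simp [Matrix.mul_apply, Fin.sum_univ_two, Pi.add_apply, Pi.smul_apply, smul_eq_mul] <;> ring
  have h := congrArg Matrix.det hgP
  have hM : (!![(1 : F), b; 0, c] : Matrix (Fin 2) (Fin 2) F).det = c := by
    rw [Matrix.det_fin_two_of]; ring
  rw [Matrix.det_mul, Matrix.det_mul, hM, mul_comm _ c] at h
  exact mul_right_cancel₀ hPdet h

variable (W : WeierstrassCurve ℚ) [W.IsElliptic] (p : ℕ) [hp : Fact p.Prime]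

/-- **The determinant step.**  If `φ ∈ Γ_ℚ` fixes a non-zero `T₀ ∈ W[p]` and acts on `W[p]/ℤT₀` as an integer scalar `a`
(`φ x − a x ∈ ℤ T₀` for all `x`), then `χ̄_p(φ) = a (mod p)`: in a frame `e : W[p] ≃ 𝔽_p²` the matrix of `φ` is `(1 b; 0 a)`
and `det ρ̄_{W,p} = χ̄_p` by the Weil pairing (tree `exists_frame_galoisRepTorsion_rat`). [cite: Serre1972, §1.11 and §5.2 (iii)]
[cite: SilvermanAEC2009, III.8.1] -/
theorem intCast_eq_of_smul_eq_self_of_forall_sub_zsmul_mem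
    {T₀ : geomTorsion W (p : ℤ)} (hT₀ : T₀ ≠ 0) {φ : absoluteGaloisGroup ℚ} (hfix : φ • T₀ = T₀)
    {a : ℤ} (hquot : ∀ x : geomTorsion W (p : ℤ), φ • x - a • x ∈ AddSubgroup.zmultiples T₀) :
    ((modPCyclotomicCharacterZMod ℚ p φ : (ZMod p)ˣ) : ZMod p) = (a : ZMod p) := by
  obtain ⟨e, Φ, he, -, hdet, -, -⟩ := exists_frame_galoisRepTorsion_rat W p
  set g : Matrix (Fin 2) (Fin 2) (ZMod p) :=
    ((Φ (galoisRepTorsion W p φ) : GL (Fin 2) (ZMod p)) : Matrix (Fin 2) (Fin 2) (ZMod p)) with hg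
  have hact : ∀ x : geomTorsion W (p : ℤ), e (φ • x) = g *ᵥ e x := fun x ↦ by
    rw [show φ • x = Multiplicative.toAdd (galoisRepTorsion W p φ) x from rfl, he]
  have hev : e T₀ ≠ 0 := fun h0 ↦ hT₀ (e.injective (h0.trans (map_zero e).symm))
  have hgv : g *ᵥ e T₀ = e T₀ := by rw [← hact, hfix]
  have hgq : ∀ w : Fin 2 → ZMod p, ∃ b : ZMod p, g *ᵥ w - (a : ZMod p) • w = b • e T₀ := by
    intro w
    obtain ⟨k, hk⟩ := AddSubgroup.mem_zmultiples_iff.mp (hquot (e.symm w))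
    refine ⟨(k : ZMod p), ?_⟩
    have h1 := congrArg e hk
    rw [map_zsmul, map_sub, map_zsmul, hact, e.apply_symm_apply] at h1
    rw [Int.cast_smul_eq_zsmul, Int.cast_smul_eq_zsmul, ← h1]
  have h1 := det_eq_of_mulVec_eq_self_of_forall_sub_smul hev hgv hgq
  have h2 := congrArg (fun u : (ZMod p)ˣ ↦ (u : ZMod p)) (hdet φ)
  simp only [Matrix.GeneralLinearGroup.val_det_apply] at h2
  rw [← h2, ← hg, h1]

end Det

/-! ### §1 `√p* ∈ ℚ(ζ_p)`: an element with trivial mod-`p` cyclotomic character fixes `√p*` -/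

section Gauss

variable (p : ℕ) [hp : Fact p.Prime]

/-- **`χ̄_p(σ) = 1 ⇒ σ√p* = √p*`** (`p` odd, `p* = (−1)^{⌊p/2⌋} p`): the quadratic Gauss sum `g = Σ_a (a/p) ζ_p^a ∈ ℚ(ζ_p)`
has `g² = p*` (Mathlib `gaussSum_sq`), `σ ζ_p = ζ_p^{χ̄_p(σ)} = ζ_p`, so `√p* = ±g` is fixed.  The tree's
`Kato2004.smul_geomSqrt_primeStar_eq` asks `σ` to fix all `p`-power roots of unity; only `ζ_p` is needed.
[cite: IrelandRosen1990, Prop. 6.3.2] -/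
theorem smul_geomSqrt_pStar_eq_of_modPCyclotomicCharacterZMod_eq_one (hp2 : p ≠ 2) {σ : absoluteGaloisGroup ℚ}
    (hσ : modPCyclotomicCharacterZMod ℚ p σ = 1) :
    σ • geomSqrt (((-1 : ℚ) ^ (p / 2)) * p) = geomSqrt (((-1 : ℚ) ^ (p / 2)) * p) := by
  have hpP : p.Prime := hp.out
  haveI : NeZero p := ⟨hpP.ne_zero⟩
  haveI : NeZero ((p : ℕ) : AlgebraicClosure ℚ) := ⟨by exact_mod_cast hpP.ne_zero⟩
  -- a primitive `p`-th root of unity `ζ`, the additive character `a ↦ ζ^a`, the Legendre character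
  obtain ⟨ζ, hζ⟩ := HasEnoughRootsOfUnity.exists_primitiveRoot (AlgebraicClosure ℚ) p
  have hψ := AddChar.zmodChar_primitive_of_primitive_root p hζ
  set ψ : AddChar (ZMod p) (AlgebraicClosure ℚ) :=
    AddChar.zmodChar p ((IsPrimitiveRoot.iff_def ζ p).mp hζ).left with hψdef
  set χ : MulChar (ZMod p) (AlgebraicClosure ℚ) :=
    (quadraticChar (ZMod p)).ringHomComp (Int.castRingHom (AlgebraicClosure ℚ)) with hχdef
  have hF : ringChar (ZMod p) ≠ 2 := by rw [ZMod.ringChar_zmod_n]; exact hp2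
  have hχ1 : χ ≠ 1 :=
    (MulChar.ringHomComp_ne_one_iff (Int.castRingHom (AlgebraicClosure ℚ)).injective_int).mpr
      (quadraticChar_ne_one hF)
  have hχ2 : χ.IsQuadratic := (quadraticChar_isQuadratic (ZMod p)).comp _
  -- the Gauss sum and its square
  set g : AlgebraicClosure ℚ := gaussSum χ ψ with hgdef
  have hodd : p % 2 = 1 := Nat.odd_iff.mp (hpP.odd_of_ne_two hp2)
  have hg2 : g ^ 2 = algebraMap ℚ (AlgebraicClosure ℚ) (((-1 : ℚ) ^ (p / 2)) * p) := by
    rw [hgdef, gaussSum_sq hχ1 hχ2 hψ, ZMod.card p, hχdef, MulChar.ringHomComp_apply,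
      quadraticChar_neg_one hF, ZMod.card p, ZMod.χ₄_eq_neg_one_pow hodd]
    simp
  -- `σ` fixes `ζ`: `σ ζ = ζ ^ χ̄_p(σ) = ζ`
  have hσζ' : σ • ζ = ζ := by
    rw [modNCyclotomicCharacter_spec ℚ p σ ζ hζ.pow_eq_one, ← modPCyclotomicCharacterZMod_eq_modNCyclotomicCharacter,
      hσ, Units.val_one, ZMod.val_one, pow_one]
  have hσζ : absoluteGaloisGroup.toAlgEquiv ℚ σ ζ = ζ := by
    rwa [absoluteGaloisGroup.smul_def] at hσζ'
  have hσg : absoluteGaloisGroup.toAlgEquiv ℚ σ g = g := by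
    rw [hgdef, gaussSum, map_sum]
    refine Finset.sum_congr rfl fun a _ ↦ ?_
    rw [map_mul, hχdef, MulChar.ringHomComp_apply, eq_intCast, map_intCast, hψdef,
      AddChar.zmodChar_apply, map_pow, hσζ]
  -- `√p* = ± g`
  have hsq : geomSqrt (((-1 : ℚ) ^ (p / 2)) * p) ^ 2 = g ^ 2 := (geomSqrt_sq _).trans hg2.symm
  rcases sq_eq_sq_iff_eq_or_eq_neg.mp hsq with h | h
  · rw [absoluteGaloisGroup.smul_def, h, hσg]
  · rw [absoluteGaloisGroup.smul_def, h, map_neg, hσg]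

end Gauss

/-! ### §2 The kernel-of-reduction line of a good ordinary curve and an inertia-corrected Frobenius -/

section Kernel

variable {V : WeierstrassCurve ℚ} [V.IsElliptic] [V.IsGloballyMinimal] {p : ℕ} [hp : Fact p.Prime]

/-- **The kernel-of-reduction line `K ≤ V[p]` and a Frobenius with trivial cyclotomic character** (Serre 1972 §1.11, at a good
ORDINARY odd prime `p` of a globally minimal `V/ℚ`; `v` the place at `p`).  There are a prime `𝔓` of `\bar ℤ` above `v`, a
subgroup `K ≤ V[p]` of order `p` (the kernel of `red : V[p] → Ṽ(𝔽̄_p)`) with `τ x − x ∈ K` for all `τ ∈ I_𝔓` (inertia acts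
trivially on the reduction, `geomReduction_smul_of_mem_inertia`), and `φ ∈ D_𝔓` with `χ̄_p(φ) = 1` and `φ x − a_p(V) x ∈ K` for all
`x ∈ V[p]` (`φ = σ τ₀`: an arithmetic Frobenius `σ`, acting on the reduction of `V[p]` by `a_p`, `geomReduction_smul_eq_frobeniusTrace_smul`,
times an inertia element with `χ̄_p(τ₀) = χ̄_p(σ)⁻¹`, `χ̄_p(I_𝔓) = 𝔽_pˣ`).  `K ≠ ⊤` because the reduction is non-zero on `V[p]`
(`p ∤ a_p`), `K ≠ ⊥` because an inertia element with `χ̄_p = −1 ≠ 1` cannot act trivially on `V[p]` (determinant, §0).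
[cite: Serre1972, §1.11 (1) and Prop. 11] [cite: Mazur1972, §1 (anomalous primes)] -/
theorem exists_kernelLine_frobenius (hp2 : p ≠ 2) (hV : GoodOrd V p)
    {v : HeightOneSpectrum (𝓞 ℚ)} (hpv : ((p : ℕ) : 𝓞 ℚ) ∈ v.asIdeal) :
    ∃ 𝔓 ∈ v.primesAbove, ∃ K : AddSubgroup (geomTorsion V (p : ℤ)), Nat.card K = p ∧
      (∀ τ ∈ 𝔓.inertia (absoluteGaloisGroup ℚ), ∀ x : geomTorsion V (p : ℤ), τ • x - x ∈ K) ∧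
      ∃ φ ∈ 𝔓.decompositionSubgroup (absoluteGaloisGroup ℚ), modPCyclotomicCharacterZMod ℚ p φ = 1 ∧
        ∀ x : geomTorsion V (p : ℤ), φ • x - (V.frobeniusTrace p) • x ∈ K := by
  have hpP : p.Prime := hp.out
  haveI : NeZero p := ⟨hpP.ne_zero⟩
  have hv : (primesEquiv v : ℕ) = p := by
    have h : natGenerator v ∣ p := by
      rw [natGenerator_dvd_iff, ← map_natCast (Rat.IsIntegralClosure.intEquiv (𝓞 ℚ)) p]
      exact Ideal.mem_map_of_mem _ hpv
    exact (Nat.prime_dvd_prime_iff_eq (prime_natGenerator v) hpP).mp h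
  have hΔ : ¬ (p : ℤ) ∣ minimalDiscriminantInt V :=
    V.not_dvd_minimalDiscriminantInt_of_hasGoodReductionAtPrime' p hV.1
  obtain ⟨𝔓, hmem, h𝔓⟩ := exists_ideal_placeOver p hv
  obtain ⟨σ, hσ⟩ := HeightOneSpectrum.exists_isArithFrobAt_of_mem_primesAbove_holds (K := ℚ) (v := v) h𝔓
  -- the reduction map on `V[p]` and its kernel `K`
  set f : geomTorsion V (p : ℤ) →+ (reductionModPrime V p).geomPoints :=
    (geomReduction hΔ).comp (geomTorsion V (p : ℤ)).subtype with hf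
  set K : AddSubgroup (geomTorsion V (p : ℤ)) := f.ker with hK
  have hmemK : ∀ x : geomTorsion V (p : ℤ), x ∈ K ↔ geomReduction hΔ (x : V.geomPoints) = 0 := fun x ↦ by
    rw [hK, AddMonoidHom.mem_ker]; rfl
  have hxp : ∀ x : geomTorsion V (p : ℤ), (p : ℤ) • (x : V.geomPoints) = 0 := fun x ↦
    (Submodule.mem_torsionBy_iff _ _).mp x.2
  -- inertia acts trivially on `V[p]/K`
  have hKI : ∀ τ ∈ 𝔓.inertia (absoluteGaloisGroup ℚ), ∀ x : geomTorsion V (p : ℤ), τ • x - x ∈ K := by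
    intro τ hτ x
    rw [hmemK, AddSubgroup.coe_sub, AddSubgroup.torsionBy.coe_smul, map_sub,
      geomReduction_smul_of_mem_inertia hΔ hmem hτ, sub_self]
  -- the Frobenius corrected by inertia
  obtain ⟨τ₀, hτ₀I, hτ₀⟩ :=
    exists_mem_inertia_modPCyclotomicCharacterZMod_eq p hpv h𝔓 (modPCyclotomicCharacterZMod ℚ p σ)⁻¹
  have hID : 𝔓.inertia (absoluteGaloisGroup ℚ) ≤ 𝔓.decompositionSubgroup (absoluteGaloisGroup ℚ) :=
    Ideal.inertia_le_decompositionSubgroup _ _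
  have hσD : σ ∈ 𝔓.decompositionSubgroup (absoluteGaloisGroup ℚ) := by
    haveI := h𝔓.1
    exact hσ.mem_stabilizer
  have hφD : σ * τ₀ ∈ 𝔓.decompositionSubgroup (absoluteGaloisGroup ℚ) := Subgroup.mul_mem _ hσD (hID hτ₀I)
  have hφχ : modPCyclotomicCharacterZMod ℚ p (σ * τ₀) = 1 := by rw [map_mul, hτ₀, mul_inv_cancel]
  have hφa : ∀ x : geomTorsion V (p : ℤ), (σ * τ₀) • x - (V.frobeniusTrace p) • x ∈ K := by
    intro x
    have hpx : (p : ℤ) • (τ₀ • (x : V.geomPoints)) = 0 := by rw [smul_comm, hxp x, smul_zero]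
    rw [hmemK, AddSubgroup.coe_sub, AddSubgroup.torsionBy.coe_smul, AddSubgroupClass.coe_zsmul, map_sub,
      map_zsmul, mul_smul, geomReduction_smul_eq_frobeniusTrace_smul hΔ hmem hv h𝔓 hσ _ hpx,
      geomReduction_smul_of_mem_inertia hΔ hmem hτ₀I, sub_self]
  -- `K ≠ ⊤`: the reduction is non-zero on `V[p]`
  obtain ⟨P, hP, hPred⟩ := exists_zsmul_eq_zero_geomReduction_ne_zero p hΔ hV.2
  set T₁ : geomTorsion V (p : ℤ) := ⟨P, (Submodule.mem_torsionBy_iff _ _).mpr hP⟩ with hT₁def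
  have hT₁K : T₁ ∉ K := by rw [hmemK]; exact hPred
  have hT₁ : T₁ ≠ 0 := by
    intro h0
    apply hPred
    have : (T₁ : V.geomPoints) = 0 := by rw [h0]; rfl
    rw [show P = (T₁ : V.geomPoints) from rfl, this, map_zero]
  -- `K ≠ ⊥`: an inertia element with `χ̄_p = -1` does not act trivially (det)
  have hKbot : K ≠ ⊥ := by
    intro hbot
    obtain ⟨τ, hτI, hτχ⟩ := exists_mem_inertia_modPCyclotomicCharacterZMod_eq p hpv h𝔓 (-1)
    have htriv : ∀ x : geomTorsion V (p : ℤ), τ • x = x := fun x ↦ by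
      have h := hKI τ hτI x
      rw [hbot, AddSubgroup.mem_bot, sub_eq_zero] at h
      exact h
    have h1 := intCast_eq_of_smul_eq_self_of_forall_sub_zsmul_mem V p hT₁ (htriv T₁) (a := 1)
      (fun x ↦ by rw [htriv, one_zsmul, sub_self]; exact AddSubgroup.zero_mem _)
    rw [hτχ, Units.val_neg, Units.val_one, Int.cast_one] at h1
    have h2 : ((2 : ℕ) : ZMod p) = 0 := by
      rw [show ((2 : ℕ) : ZMod p) = 1 + 1 by norm_num]
      nth_rw 1 [← h1]
      exact neg_add_cancel 1
    rw [ZMod.natCast_eq_zero_iff] at h2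
    exact hp2 ((Nat.prime_dvd_prime_iff_eq hpP Nat.prime_two).mp h2)
  -- `#K = p`
  have hcardV : Nat.card (geomTorsion V (p : ℤ)) = p ^ 2 := Rank1Residual.natCard_geomTorsion V p
  haveI : Finite (geomTorsion V (p : ℤ)) := Nat.finite_of_card_ne_zero (by rw [hcardV]; exact pow_ne_zero _ hpP.ne_zero)
  have hKcard : Nat.card K = p := by
    have hdvd : Nat.card K ∣ p ^ 2 := hcardV ▸ K.card_addSubgroup_dvd_card
    obtain ⟨i, hi, hKi⟩ := (Nat.dvd_prime_pow hpP).mp hdvd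
    interval_cases i
    · exact absurd (AddSubgroup.eq_bot_of_card_eq K (by rw [hKi, pow_zero])) hKbot
    · rw [hKi, pow_one]
    · exfalso
      apply hT₁K
      rw [AddSubgroup.eq_top_of_card_eq K (by rw [hKi, hcardV])]
      exact AddSubgroup.mem_top _
  exact ⟨𝔓, h𝔓, K, hKcard, hKI, σ * τ₀, hφD, hφχ, hφa⟩

end Kernel

end Summit.BirchSwinnertonDyer.BirchSwinnertonDyer.Theorems.SchneiderFreeAdditiveX3.SemistableTwistLocalThree

end
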